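import Summits.QuantumFields.BalabanUV.Beta.GAN24.ThirdJetKernel
import Summits.QuantumFields.BalabanUV.Beta.GAN24.DilationCovariance

/-!
# `BalabanUV.Beta.GAN24.DilatedBorderThirdJet` — binder row G-an2-4 / (CONV-C), S-slot («E3Shape» ∧ «E3SupRate»), road S3, DIFF row
# **R3-dV** (typer `LEAVES.md` v3.3 PART III § III.R, holder `b2b-balaban-gan24-formalise-leaf-03-g15`, INTENT «ROW-dV*» journal l.5224),
# part 1 (generic `d`): THE THIRD JET OF AN `Lc`-CONTOUR-SUMMED LIFTED TABLE THROUGH THE ONE-SHOT RESOLVENT AT BLOCKING `Lc·N` IS THE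
# THIRD-JET FUNCTIONAL THROUGH THE `Lc`-DECIMATED RESOLVENT AT BLOCKING `N` — the depth-`k ≥ 1` analogue of leaf-05-g19's top-row identity
# `TopBorderKSlot.e3OfS_borderInc_top`, and its instance for the PUSHED BORDER INCREMENTS of an2's composite family (rows V ∕ dV).

NOT IN PRINT; OUR BOOKKEEPING.  HONEST FRAMING (cell contract, verbatim): «discharging `BetaPertH` makes Bałaban's UV stability
UNCONDITIONAL — a real constructive-QFT result; it is NOT the continuum limit and NOT the Clay problem.»  HONEST DEPENDENCY (verbatim):
«continuum YM on T⁴ ⇐ BetaPertH ∧ nine spine estimates (0/9 proved); BetaPertH ⇐ (D1) ∧ (D4) ∧ CAP+tail; G-an2-4 gates asym, D1 and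
NE2/3/4.»  [folklore] identities over tree theorems BY NAME — an4's stencil-index swap `DecLiftAdjoint.vertexOfK_borderSum` (I1) and
`vertexOfK_avgLift`, an2's sandwich identity `InterLevelTransport.dec_comp_avgLift_comp` (I2), `BalabanStepJetsSucc.mmRead` ∕ `OneStepKernelFamily.dec`
(I3), leaf-05-g18's EXACT dilation covariance `DilationCovariance.pushSum_borderInc_mul` («DILATE*», typer row T-DIL), leaf-05-g19's functional
`ThirdJetKernel.e3K`; NO estimate on Bałaban's kernels (the only analysis is the absolute convergence behind (I1)/(I2), from the tree's
per-`N` `decays_KInv` and the finite range of an1's `vhS`), NO cited fact, NO `def`, NO `def … : Prop`, NO wall binder; the reserved family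
`GAN24.StencilSlotE3*` is untouched.  Discharges NOTHING of «E3Shape»/«E3SupRate»/(hS, hSall); NOT BetaPertH, NOT continuum, NOT Clay.

## What is proved (generic `d`, any `Lc` with `NeZero Lc`)
§1 `mmRead_mul_eq_mmRead_dec`: the `mm`-read at blocking `N′ = Lc·N` is the `mm`-read at blocking `N` of the `Lc`-decimated kernel (I3, one step).
   `abs_le_const_of_locStencil`: a local stencil family is entrywise bounded by its constant.
§2 **`e3OfS_borderSum_eq_e3K_dec`** — THE IDENTITY.  For ANY bounded local level-table family `G` (one kernel per fine bond of the `N`-system),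
   any weight `c`, `N′ = Lc·N`:
   `e3OfS N′ (c • borderSum Lc G) κ′ u′ = e3K (dec Lc (KInv N′)) N ((c·Lc^{d+2}) • G) κ′ u′`
   — reading the `Lc`-contour-summed `Lc`-lift of `G` through the THREE legs of the one-shot resolvent `KInv N′` is reading `G` itself through
   the three legs of the `Lc`-DECIMATED resolvent `dec Lc (KInv N′)` (a kernel on the `N`-system's fine lattice: field legs = `Lc`-block-contour
   MEANS of the level-`N′` legs, multiplier legs re-indexed), the factor `Lc^{d+2}` being (I1)'s contour-leg count.
§3 THE PUSHED BORDER INCREMENTS (rows V∕dV of the S3 tables).  `pushSum_borderInc_mul_eq_borderSum`: member `p+1`'s depth-`k` table IS the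
   `Lc`-contour sum of member `p`'s: `pushSum (Lc·M′) L ∘ borderInc d Lc (Lc·M) = borderSum Lc (pushSum M′ L ∘ borderInc d Lc M)` (leaf-05-g18's
   `pushSum_borderInc_mul`, repackaged); `locStencil_pushSum_borderInc` (the table is a local stencil family, rate `1`, explicit constant);
   **`e3OfS_pushed_border_succ`**: `e3OfS N′ (c • pushSum (Lc·M′) L ∘ borderInc d Lc (Lc·M)) κ′ u′ = e3K (dec Lc (KInv N′)) N ((c·Lc^{d+2}) • pushSum M′ L ∘ borderInc d Lc M) κ′ u′`.
§4 `e3OfS_pushed_border_pow_succ`: the same in the S3 tables' literal indexing (member `n+3` = `Lc^{n+3}`, level `m+2`, push base `Lc^{m+3}`,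
   `L = Lc^{n−m}` pushes, vs member `n+2`'s table at level `m+1`), with member `n+3`'s natural weight.
READING (displayed, not claimed): with this identity the DIFF row dV is a difference of ONE trilinear functional of member `n+2`'s table at two
KERNELS — `dec Lc (KInv (Lc^{n+3}))` in `Lc^{n+3}`-units vs `KInv (Lc^{n+2})` in `Lc^{n+2}`-units — whose leg-by-leg comparison is the located
input «(N1-Cauchy)» (field legs: cell means of `H̃`, `G̃ = −H̃ᵀ`) + (N1′) (contour-vs-cell means) + the K-slot's `CauchyDecayK` (multiplier legs);
nothing of that comparison is asserted here.
-/

noncomputable section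

open Finset
open scoped BigOperators
open Literature.MathematicalPhysics.QuantumFieldTheory
open Literature.MathematicalPhysics.QuantumFieldTheory.Balaban1983to89
open Literature.MathematicalPhysics.QuantumFieldTheory.Balaban1983to89.Beta
open LatticeForm (quo)
open B12Sec2to5 (l1 l1_nonneg)
open ExpKernelCalculus (MKer Decays BiLoc comp)
open OneStepResolventKernel (Fib LocStencil KInv vertexOf decays_KInv)
open OneStepKernelFamily (dec legSet legW legPt vertexOfK vertexOfK_KInv vertexFamily_vertexOfK' decays_dec')
open BalabanStepJetsSucc (mmRead mmRead_inl_inl mmRead_inr_left mmRead_inr_right)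
open StepJetData (mfNeg locStencil_mfNeg)
open AveragingHessianKernels (vhS locStencil_vhS ell)
open InterLevelTransport (avgLift dec_comp_avgLift_comp)
open BalabanCompositeJets (pushSum bshift borderInc biLoc_pushSum locStencil_borderInc)
open DecLiftAdjoint (borderSum vertexOfK_borderSum vertexOfK_avgLift avgLift_smul vertexOfK_smul)
open Summit.QuantumFields.BalabanUV.Beta.GAN24.E3UnitSplit (e3OfS e3OfS_inl_inr e3OfS_inr)
open Summit.QuantumFields.BalabanUV.Beta.GAN24.ThirdJetKernel (e3K e3K_inl_inl e3K_inr_left e3K_inr_right e3K_smul)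
open Summit.QuantumFields.BalabanUV.Beta.GAN24.DilationCovariance (pushSum_borderInc_mul)

namespace Summit.QuantumFields.BalabanUV.Beta.GAN24.DilatedBorderThirdJet

variable {d : ℕ} {Lc : ℕ} [NeZero Lc]

/-! ## §1 One decimation step in the `mm`-read; entrywise bounds of local families -/

omit [NeZero Lc] in
/-- [folklore] **(I3), ONE STEP**: the `mm`-read at blocking `N′ = Lc·N` is the `mm`-read at blocking `N` of the `Lc`-decimated kernel
(multiplier legs of `dec Lc` are read at the `Lc`-dilated points with weight one; `(Lc·N)•x = Lc•(N•x)`). -/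
theorem mmRead_mul_eq_mmRead_dec {N N' : ℕ} (hN : N' = Lc * N) (F : MKer (d + 1) (Fib d)) (x z : Fin (d + 1) → ℤ) (a b : Fib d) :
    mmRead N' F x z a b = mmRead N (dec Lc F) x z a b := by
  subst hN
  rcases a with α | μ <;> rcases b with β | ν
  · rw [mmRead_inl_inl, mmRead_inl_inl]
    simp only [dec, legSet, legW, legPt, Finset.sum_singleton, one_mul, smul_smul]
    push_cast
    rfl
  · simp only [mmRead_inr_right]
  · simp only [mmRead_inr_left]
  · simp only [mmRead_inr_left]

omit [NeZero Lc] in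
/-- [folklore] A local stencil family with nonnegative rate is entrywise bounded by its constant. -/
theorem abs_le_const_of_locStencil {S : Fin (d + 1) → (Fin (d + 1) → ℤ) → MKer (d + 1) (Fib d)} {Cs δ : ℝ}
    (hS : LocStencil S Cs δ) (hδ : 0 ≤ δ) (κ : Fin (d + 1)) (z x w : Fin (d + 1) → ℤ) (a b : Fib d) :
    |S κ z x w a b| ≤ Cs := by
  have hCs : 0 ≤ Cs := (hS κ z).nonneg (Sum.inl 0)
  refine (hS κ z x w a b).trans (mul_le_of_le_one_right hCs ?_)
  rw [Real.exp_le_one_iff]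
  nlinarith [l1_nonneg (x - z), l1_nonneg (w - z)]

omit [NeZero Lc] in
/-- [folklore] A scalar multiple of a local stencil family is a local stencil family (constant `|c|·Cs`). -/
theorem locStencil_smul' {S : Fin (d + 1) → (Fin (d + 1) → ℤ) → MKer (d + 1) (Fib d)} {Cs δ : ℝ} (hS : LocStencil S Cs δ) (c : ℝ) :
    LocStencil (fun κ u => c • S κ u) (|c| * Cs) δ := by
  intro κ u x w a b
  simp only [Pi.smul_apply, smul_eq_mul, abs_mul, mul_assoc]
  exact mul_le_mul_of_nonneg_left (hS κ u x w a b) (abs_nonneg c)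

/-! ## §2 THE IDENTITY: third jet of a contour-summed lifted table = third-jet functional through the decimated resolvent -/

/-- [folklore] **`e3OfS_borderSum_eq_e3K_dec` — THE THIRD JET OF AN `Lc`-CONTOUR-SUMMED LIFTED TABLE THROUGH THE ONE-SHOT RESOLVENT AT
BLOCKING `N′ = Lc·N` IS THE THIRD-JET FUNCTIONAL THROUGH THE `Lc`-DECIMATED RESOLVENT AT BLOCKING `N`** (exact, entrywise; generic `d`).  For a
bounded local level-table family `G` (hypotheses: `LocStencil G Cs δ` with `0 < δ` — only its boundedness and the absolute convergence of the
chain-rule vertex are used) and any weight `c`: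
`e3OfS N′ (fun κ u => c • borderSum Lc G κ u) κ′ u′ = e3K (dec Lc (KInv N′)) N (fun κ z => (c·Lc^{d+2}) • G κ z) κ′ u′`.
Mechanism: `vertexOf = vertexOfK (KInv N′) N′` (`vertexOfK_KInv`); (I1) `vertexOfK_borderSum` (the `ℋ_{N′}`-weights of one fine bond of the
`N`-system are summed over its `Lc^{d+2}` contour legs: factor `Lc^{d+2}`, kernel `dec Lc (KInv N′)`); `vertexOfK_avgLift` (the lift commutes
with the vertex contraction); (I3) `mmRead_mul_eq_mmRead_dec`; (I2) `dec_comp_avgLift_comp` (the lift is adjoint to decimation on the two outer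
legs; Fubini from `decays_KInv` and the bi-localisation of the vertex, `vertexFamily_vertexOfK'` ∘ `decays_dec'`). -/
theorem e3OfS_borderSum_eq_e3K_dec {N N' : ℕ} [NeZero N] [NeZero N'] (hN : N' = Lc * N)
    {G : Fin (d + 1) → (Fin (d + 1) → ℤ) → MKer (d + 1) (Fib d)} {Cs δ : ℝ} (hG : LocStencil G Cs δ) (hδ : 0 < δ)
    (c : ℝ) (κ' : Fin (d + 1)) (u' : Fin (d + 1) → ℤ) :
    e3OfS N' (fun κ u => c • borderSum Lc G κ u) κ' u' =
      e3K (dec Lc (KInv (N := N') (d := d))) N (fun κ z => (c * (Lc : ℝ) ^ (d + 2)) • G κ z) κ' u' := by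
  -- hypotheses of (I1)/(I2)
  obtain ⟨δK, CK, hδK, hCK, hK⟩ := decays_KInv (N := N') (d := d)
  have hLc1 : 1 ≤ Lc := Nat.one_le_iff_ne_zero.2 (NeZero.ne Lc)
  have hKd : ∃ δ C : ℝ, 0 < δ ∧ 0 ≤ C ∧ Decays (dec Lc (KInv (N := N') (d := d))) C δ :=
    decays_dec' ⟨δK, CK, hδK, hCK, hK⟩ hLc1
  obtain ⟨δd, Cd, hδd, _, hKdec⟩ := hKd
  have hGb : ∀ (κ : Fin (d + 1)) (z : Fin (d + 1) → ℤ) (x w : Fin (d + 1) → ℤ) (a b : Fib d), |G κ z x w a b| ≤ Cs :=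
    fun κ z x w a b => abs_le_const_of_locStencil hG hδ.le κ z x w a b
  have hGc : LocStencil (fun κ z => (c * (Lc : ℝ) ^ (d + 2)) • G κ z) (|c * (Lc : ℝ) ^ (d + 2)| * Cs) δ := locStencil_smul' hG _
  obtain ⟨Cv, δv, hδv, hV⟩ := vertexFamily_vertexOfK' (N := N) ⟨δd, Cd, hδd, (hKdec.nonneg (Sum.inl 0)), hKdec⟩ hGc hδ
  funext x z a b
  rcases a with α | μ
  · rcases b with β | ν
    · rw [e3K_inl_inl]
      show -(mmRead N' (comp (comp (KInv (N := N') (d := d))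
          (vertexOf (N := N') (fun κ u => c • borderSum Lc G κ u) κ' u')) (KInv (N := N') (d := d))) x z (Sum.inl α) (Sum.inl β)) = _
      rw [← vertexOfK_KInv, vertexOfK_smul, vertexOfK_borderSum hK hδK hGb hN κ' u', vertexOfK_avgLift hKdec hδd N Lc hGb κ' u',
        smul_smul, ← avgLift_smul, ← vertexOfK_smul, mmRead_mul_eq_mmRead_dec hN, mmRead_inl_inl,
        dec_comp_avgLift_comp Lc hK hδK.le hK hδK.le (hV κ' u') hδv]
    · simp only [e3OfS_inl_inr, e3K_inr_right]
  · simp only [e3OfS_inr, e3K_inr_left]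

/-! ## §3 The pushed border increments of an2's composite family (rows V ∕ dV) -/

/-- [folklore] **MEMBER `p+1`'s DEPTH-`k` BORDER TABLE IS THE `Lc`-CONTOUR SUM OF MEMBER `p`'s** (leaf-05-g18's exact dilation covariance
`DilationCovariance.pushSum_borderInc_mul`, repackaged as a `borderSum`): `pushSum (Lc·M′) L (borderInc d Lc (Lc·M) κ u) =
borderSum Lc (fun κ z => pushSum M′ L (borderInc d Lc M κ z)) κ u`. -/
theorem pushSum_borderInc_mul_eq_borderSum (M M' L : ℕ) :
    (fun κ u => pushSum (Lc * M') L (borderInc d Lc (Lc * M) κ u)) =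
      borderSum Lc (fun κ z => pushSum M' L (borderInc d Lc M κ z)) := by
  funext κ u
  rw [pushSum_borderInc_mul Lc Lc M M' L κ u]
  funext x w a b
  simp only [borderSum]

omit [NeZero Lc] in
/-- [folklore] **THE PUSHED BORDER TABLE IS A LOCAL STENCIL FAMILY** (rate `1`, explicit constant: `locStencil_borderInc` at `δ = 1` — an1's `vhS`
has finite range — pushed by `biLoc_pushSum`; only used to feed the Fubini hypotheses of §2). -/
theorem locStencil_pushSum_borderInc_one (hLc : 1 ≤ Lc) (M M' L : ℕ) [NeZero M] [NeZero M'] [NeZero L] (hL : 1 ≤ L) :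
    LocStencil (fun κ z => pushSum M' L (borderInc d Lc M κ z))
      ((M * (3 * (ell (d + 1) Lc : ℝ) ^ 2 * Real.exp (4 * ((d : ℝ) + 1) * Lc * (M * 1)) * Real.exp (4 * (d + 1) * (M * 1)) *
        Real.exp (2 * 1 * ((d + 2) * M)))) * (((L : ℝ) ^ (d + 2)) ^ 2) * Real.exp (4 * ((d : ℝ) + 1) * M' * L * 1)) 1 := by
  intro κ z
  exact biLoc_pushSum hL (locStencil_borderInc (d := d) (M := M) hLc zero_le_one κ z) zero_le_one

/-- [folklore] **`e3OfS_pushed_border_succ` — ROWS V∕dV: MEMBER `p+1`'s PUSHED BORDER PIECE THROUGH ITS ONE-SHOT RESOLVENT IS THE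
THIRD-JET FUNCTIONAL OF MEMBER `p`'s TABLE THROUGH THE `Lc`-DECIMATED RESOLVENT** (exact; generic `d`; `N′ = Lc·N`, any `M, M′, L ≥ 1`, any
weight `c`): `e3OfS N′ (c • pushSum (Lc·M′) L ∘ borderInc d Lc (Lc·M)) κ′ u′ = e3K (dec Lc (KInv N′)) N ((c·Lc^{d+2}) • pushSum M′ L ∘ borderInc d Lc M) κ′ u′`. -/
theorem e3OfS_pushed_border_succ (hLc : 1 ≤ Lc) {N N' : ℕ} [NeZero N] [NeZero N'] (hN : N' = Lc * N)
    (M M' L : ℕ) [NeZero M] [NeZero M'] [NeZero L] (hL : 1 ≤ L) (c : ℝ) (κ' : Fin (d + 1)) (u' : Fin (d + 1) → ℤ) :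
    e3OfS N' (fun κ u => c • pushSum (Lc * M') L (borderInc d Lc (Lc * M) κ u)) κ' u' =
      e3K (dec Lc (KInv (N := N') (d := d))) N (fun κ z => (c * (Lc : ℝ) ^ (d + 2)) • pushSum M' L (borderInc d Lc M κ z)) κ' u' := by
  have h := e3OfS_borderSum_eq_e3K_dec (d := d) hN (locStencil_pushSum_borderInc_one (d := d) hLc M M' L hL) one_pos c κ' u'
  rw [← pushSum_borderInc_mul_eq_borderSum] at h
  exact h

/-! ## §4 The S3 tables' literal indexing (member `n+3`, level `m+2`, `n−m` pushes, vs member `n+2`'s table at level `m+1`) -/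

/-- [folklore] **ROW dV's FIRST LINE** (the S3 RATE table's literal shapes, `StencilSlotE3RateOfPieces` hypothesis `dV`, member `n+3` side):
`e3OfS (Lc^{n+3}) (w • pushSum (Lc^{m+3}) (Lc^{n−m}) ∘ borderInc d Lc (Lc^{m+2})) κ′ u′
   = e3K (dec Lc (KInv (Lc^{n+3}))) (Lc^{n+2}) ((w·Lc^{d+2}) • pushSum (Lc^{m+2}) (Lc^{n−m}) ∘ borderInc d Lc (Lc^{m+1})) κ′ u′`
— member `n+3`'s depth-`(n−m)` piece is member `n+2`'s depth-`(n−m)` table read through the `Lc`-decimated level-`(n+3)` resolvent. -/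
theorem e3OfS_pushed_border_pow_succ (hLc : 1 ≤ Lc) (n m : ℕ) (w : ℝ) (κ' : Fin (d + 1)) (u' : Fin (d + 1) → ℤ) :
    e3OfS (Lc ^ (n + 1 + 1 + 1))
        (fun κ u => w • pushSum (Lc ^ (m + 1 + 1 + 1)) (Lc ^ (n - m)) (borderInc d Lc (Lc ^ (m + 1 + 1)) κ u)) κ' u' =
      e3K (dec Lc (KInv (N := Lc ^ (n + 1 + 1 + 1)) (d := d))) (Lc ^ (n + 1 + 1))
        (fun κ z => (w * (Lc : ℝ) ^ (d + 2)) • pushSum (Lc ^ (m + 1 + 1)) (Lc ^ (n - m)) (borderInc d Lc (Lc ^ (m + 1)) κ z)) κ' u' := by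
  have hL : 1 ≤ Lc ^ (n - m) := Nat.one_le_pow _ _ (Nat.lt_of_lt_of_le Nat.zero_lt_one hLc)
  have e1 : Lc ^ (m + 1 + 1 + 1) = Lc * Lc ^ (m + 1 + 1) := pow_succ' Lc (m + 1 + 1)
  have e2 : Lc ^ (m + 1 + 1) = Lc * Lc ^ (m + 1) := pow_succ' Lc (m + 1)
  have h := e3OfS_pushed_border_succ (d := d) hLc (N := Lc ^ (n + 1 + 1)) (N' := Lc ^ (n + 1 + 1 + 1)) (pow_succ' Lc (n + 1 + 1))
    (Lc ^ (m + 1)) (Lc ^ (m + 1 + 1)) (Lc ^ (n - m)) hL w κ' u'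
  rw [← e2, ← e1] at h
  exact h

end Summit.QuantumFields.BalabanUV.Beta.GAN24.DilatedBorderThirdJet

end
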